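import Summits.Ventures.HSemireg.WedgeHankelOuterFamilyPure
import Summits.Ventures.HSemireg.WedgeHankelOuterPieces

/-!
# Venture HSemireg — THE PAIR-TYPE PIECES OF A JOINT RANGE: for every finite TRANSVERSAL family `(f_c)_c` the joint range `JR_k(f) = {(θ ∧ f_c)_c : θ ∈ Hom(univ,k)}`
# meets the tuples of pair type `τ + 𝟙` exactly in the image of the `τ`-piece; rank–nullity holds PIECE BY PIECE; the full-pair pieces of the JOINT KERNEL are everything
# and carry no joint image; and for th-7's classes `f_c = w_N(q_c)` **every `k`-set `A` of pairs contributes exactly `rank [H_k(q_c)]_c` to the joint range**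

HONEST FRAMING. Part of the Lean index of the computation cell `pub-hsemireg` (seat p10 gen 24, Sunday typer «UNIFORM-IN-n»).
Finite-dimensional EXTERIOR ALGEBRA over a field ONLY: no variety, no cohomology theory, no sheaf, no Ext group, no semiregularity map;
nothing here says that HC / HC_CM / HC_AV holds; no Literature fact is declared or used.  Custodian versions as in `WedgeHankelSiegelIdeal` (1/3); the dictionary (pair type `𝟙_A` = the
Künneth piece with one degree from each factor in `A`; `JR` = the joint image of `θ ↦ (θ ∧ w_N(q_c))_c`) is QUOTED, never asserted.

WHAT IS IN THE TREE.  K39 (`WedgeHankelOuterValue`): `finrank_inf_iInf_Kr_add_finrank_JR` (joint rank–nullity on a block); J1/J2 (`WedgeHankelOuterFamily`, `…FamilyPure`): the joint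
kernel law and its pure pieces `finrank_iInf_Kr_w_inf_Sp_pure_add`; L4 (`WedgeHankelOuterPieces`): `Sp_ptype_le_ker_of_two_le`, `V_inf_Sp_ptype_succ_eq_map`, `Hom_inf_Sp_pure` (one class);
I5 (`WedgeHankelPairGradingMaps`): `proj_ptype_succ_mul`, `proj_ptype_mul_eq_zero_of_exists_zero`; H10: `mul_mem_Sp_ptype_succ`, `proj_mem_Hom`; th-7's `JR`, `L` (`WedgeHankelTuples`).
THIS FILE (namespace `Summit.Ventures.HSemireg.Wedge.HankelOuter` continued; imports J2 and L4; the tuple-side piece of type `σ` is written `Submodule.pi univ (fun _ => Sp(ptype = σ))`, no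
new definition):
* §400 THE FULL-PAIR PIECES OF A JOINT KERNEL ARE EVERYTHING: `Hom_inf_Sp_ptype_le_iInf_Kr_of_two_le`, **`Hom_iInf_Kr_inf_Sp_ptype_eq_Hom_inf_of_two_le`**
  (`Hom(univ,k) ⊓ ⋂_c Kr(univ, f_c, k) ⊓ Sp(ptype = τ) = Hom(univ,k) ⊓ Sp(ptype = τ)` when some `τ c ≥ 2`, every transversal family), `finrank_Hom_iInf_Kr_w_inf_Sp_ptype_of_two_le` (the count).
* §401 THE PIECES OF THE JOINT RANGE: `L_mem_pi_Sp_ptype_succ`, **`JR_inf_pi_Sp_ptype_succ_eq_map`** (`JR_k(f) ⊓ Π_c Sp(ptype = τ + 𝟙) = (Hom(univ,k) ⊓ Sp(ptype = τ)).map (L f)`),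
  **`finrank_JR_inf_pi_Sp_ptype_succ_add`** (RANK–NULLITY PIECE BY PIECE: `dim (JR_k(f) ⊓ Π Sp(τ+𝟙)) + dim (Hom(univ,k) ⊓ ⋂_c Kr(univ,f_c,k) ⊓ Sp(τ)) = dim (Hom(univ,k) ⊓ Sp(τ))`),
  `JR_inf_pi_Sp_ptype_eq_bot_of_exists_zero` (types with an empty pair carry no joint image, `ι` non-empty), `finrank_JR_inf_pi_Sp_ptype_succ_eq_zero_of_two_le` (full-pair types: none either).
* §402 THE VALUE FOR TH-7's FAMILY `f_c = w_N(q_c)`: **`finrank_JR_w_inf_pi_Sp_pure_succ`: `dim (JR_{|A|}((w_N q_c)_c) ⊓ Π_c Sp(ptype = 𝟙_A + 𝟙)) = rank (hank K N |A| q)`** for EVERY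
  set `A` of pairs, every finite family, every field; `finrank_JR_w_inf_pi_Sp_two_one` (type spelled `[c ∈ A] + 1`).
READING: J2's kernel table for families has the matching IMAGE table: the joint range on `k`-forms is the direct sum over the `k`-sets `A` of pieces of dimension exactly the block
Hankel rank `rank [H_k(q_c)]_c`, all other pair types contributing `0` — th-7's `C(n,k) · rank [H_k(q_c)]_c` (J1) term by term.  Nothing Ext-side.  New names only.
-/

open Module

namespace Summit.Ventures.HSemireg.Wedge.HankelOuter

open Summit.Ventures.HSemireg.Wedge Summit.Ventures.HSemireg.Wedge.Kunneth Summit.Ventures.HSemireg.Wedge.Hankel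
  Summit.Ventures.HSemireg.Wedge.BasisFree Summit.Ventures.HSemireg.Wedge.HankelSiegel Summit.Ventures.HSemireg.Wedge.HankelSiegelIdeal
  Summit.Ventures.HSemireg.Wedge.KunnethKernel Summit.Ventures.HSemireg.Wedge.HankelFrameChange Summit.Ventures.HSemireg.Wedge.Weil
  Summit.Ventures.HSemireg.Wedge.HankelPairMixing Summit.Ventures.HSemireg.Wedge.HankelPairGrading

variable (K : Type*) [Field K] {N : ℕ} {ι : Type} [Fintype ι] [DecidableEq ι]

/-! ## §400. The full-pair pieces of a joint kernel are everything -/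

omit [Fintype ι] [DecidableEq ι] in
/-- a pair type with a full pair lies in every kernel of a transversal family: `Hom(univ,k) ⊓ Sp(ptype = τ) ≤ ⋂_c Kr(univ, f_c, k)` when some `τ c ≥ 2`. -/
theorem Hom_inf_Sp_ptype_le_iInf_Kr_of_two_le {τ : Fin N → ℕ} {c₀ : Fin N} (h : 2 ≤ τ c₀) {f : ι → HT K (In N)} (hf : ∀ c, f c ∈ Sp K (Tr (N := N))) (k : ℕ) :
    Hom K (In N) (Finset.univ : Finset (In N)) k ⊓ Sp K (fun s : Finset (In N) => ptype s = τ)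
      ≤ ⨅ c, Kr K (Finset.univ : Finset (In N)) (f c) k := by
  refine le_iInf fun c => ?_
  rw [Kr]
  exact inf_le_inf le_rfl (Sp_ptype_le_ker_of_two_le K h (hf c))

omit [Fintype ι] [DecidableEq ι] in
/-- **THE FULL-PAIR PIECES OF A JOINT KERNEL ARE EVERYTHING: `Hom(univ,k) ⊓ ⋂_c Kr(univ, f_c, k) ⊓ Sp(ptype = τ) = Hom(univ,k) ⊓ Sp(ptype = τ)` when some `τ c ≥ 2`**
(every finite transversal family `f`, every degree `k`, every field). -/
theorem Hom_iInf_Kr_inf_Sp_ptype_eq_Hom_inf_of_two_le {τ : Fin N → ℕ} {c₀ : Fin N} (h : 2 ≤ τ c₀) {f : ι → HT K (In N)} (hf : ∀ c, f c ∈ Sp K (Tr (N := N))) (k : ℕ) :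
    Hom K (In N) (Finset.univ : Finset (In N)) k ⊓ (⨅ c, Kr K (Finset.univ : Finset (In N)) (f c) k) ⊓ Sp K (fun s : Finset (In N) => ptype s = τ)
      = Hom K (In N) (Finset.univ : Finset (In N)) k ⊓ Sp K (fun s : Finset (In N) => ptype s = τ) := by
  refine le_antisymm (inf_le_inf inf_le_left le_rfl) (le_inf (le_inf inf_le_left ?_) inf_le_right)
  exact Hom_inf_Sp_ptype_le_iInf_Kr_of_two_le K h hf k

omit [Fintype ι] [DecidableEq ι] in
/-- … for th-7's family `(w_N(q_c))_c`, with the dimension read off the count of supports: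
**`dim (Hom(univ,k) ⊓ ⋂_c Kr(univ, w_N q_c, k) ⊓ Sp(ptype = τ)) = #{s : |s| = k ∧ ptype s = τ}`** when some `τ c ≥ 2`. -/
theorem finrank_Hom_iInf_Kr_w_inf_Sp_ptype_of_two_le {τ : Fin N → ℕ} {c₀ : Fin N} (h : 2 ≤ τ c₀) (q : ι → ℕ → K) (k : ℕ)
    [DecidablePred fun s : Finset (In N) => s.card = k ∧ ptype s = τ] :
    finrank K ↥(Hom K (In N) (Finset.univ : Finset (In N)) k ⊓ (⨅ c, Kr K (Finset.univ : Finset (In N)) (w K N N (q c)) k)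
        ⊓ Sp K (fun s : Finset (In N) => ptype s = τ))
      = (Finset.univ.filter fun s : Finset (In N) => s.card = k ∧ ptype s = τ).card := by
  have hSp : Sp K (fun s : Finset (In N) => (s ⊆ Finset.univ ∧ s.card = k) ∧ ptype s = τ) = Sp K (fun s : Finset (In N) => s.card = k ∧ ptype s = τ) :=
    Sp_congr_iff K fun s => ⟨fun hs => ⟨hs.1.2, hs.2⟩, fun hs => ⟨⟨Finset.subset_univ _, hs.1⟩, hs.2⟩⟩
  rw [Hom_iInf_Kr_inf_Sp_ptype_eq_Hom_inf_of_two_le K h (fun c => w_mem_Sp_Tr K (q c)) k, Hom_eq_Sp, Sp_inf_Sp, hSp, finrank_Sp]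

/-! ## §401. The pair-type pieces of the joint range -/

omit [Fintype ι] [DecidableEq ι] in
/-- `(θ ∧ f_c)_c` has every component of type `τ + 𝟙` when `θ` has type `τ` (transversal family). -/
theorem L_mem_pi_Sp_ptype_succ {τ : Fin N → ℕ} {f : ι → HT K (In N)} (hf : ∀ c, f c ∈ Sp K (Tr (N := N))) {θ : HT K (In N)}
    (hθ : θ ∈ Sp K (fun s : Finset (In N) => ptype s = τ)) :
    L K f θ ∈ Submodule.pi (Set.univ : Set ι) (fun _ => Sp K (fun s : Finset (In N) => ptype s = τ + 1)) := by
  rw [Submodule.mem_pi]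
  intro c _
  rw [L_apply]
  exact mul_mem_Sp_ptype_succ K hθ (hf c)

omit [Fintype ι] [DecidableEq ι] in
/-- **THE `τ + 𝟙`-PIECE OF THE JOINT RANGE IS THE JOINT IMAGE OF THE `τ`-PIECE: `JR_k(f) ⊓ Π_c Sp(ptype = τ + 𝟙) = (Hom(univ,k) ⊓ Sp(ptype = τ)).map (L f)`** (`f` a finite
transversal family): the `τ + 𝟙`-components of `(θ ∧ f_c)_c` are `(proj_τ θ ∧ f_c)_c`. -/
theorem JR_inf_pi_Sp_ptype_succ_eq_map (τ : Fin N → ℕ) {f : ι → HT K (In N)} (hf : ∀ c, f c ∈ Sp K (Tr (N := N))) (k : ℕ) :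
    JR K (In N) (Finset.univ : Finset (In N)) k f ⊓ Submodule.pi (Set.univ : Set ι) (fun _ => Sp K (fun s : Finset (In N) => ptype s = τ + 1))
      = (Hom K (In N) (Finset.univ : Finset (In N)) k ⊓ Sp K (fun s : Finset (In N) => ptype s = τ)).map (L K f) := by
  classical
  refine le_antisymm ?_ ?_
  · rintro v ⟨hv, hvσ⟩
    obtain ⟨θ, hθ, rfl⟩ := hv
    rw [SetLike.mem_coe, Submodule.mem_pi] at hvσ
    refine ⟨proj (K := K) (fun s : Finset (In N) => ptype s = τ) θ, ⟨proj_mem_Hom K _ hθ, proj_mem _ θ⟩, ?_⟩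
    funext c
    rw [L_apply, L_apply, ← proj_ptype_succ_mul K τ θ (hf c)]
    exact proj_eq_self (fun s h => h) (hvσ c (Set.mem_univ c))
  · rintro _ ⟨θ, ⟨hθ, hθτ⟩, rfl⟩
    exact ⟨Submodule.mem_map_of_mem hθ, L_mem_pi_Sp_ptype_succ K hf hθτ⟩

omit [Fintype ι] [DecidableEq ι] in
/-- **RANK–NULLITY PIECE BY PIECE: `dim (JR_k(f) ⊓ Π_c Sp(ptype = τ + 𝟙)) + dim (Hom(univ,k) ⊓ ⋂_c Kr(univ, f_c, k) ⊓ Sp(ptype = τ)) = dim (Hom(univ,k) ⊓ Sp(ptype = τ))`**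
for every finite transversal family `f`, every pair type `τ`, every degree `k`. -/
theorem finrank_JR_inf_pi_Sp_ptype_succ_add (τ : Fin N → ℕ) {f : ι → HT K (In N)} (hf : ∀ c, f c ∈ Sp K (Tr (N := N))) (k : ℕ) :
    finrank K ↥(JR K (In N) (Finset.univ : Finset (In N)) k f ⊓ Submodule.pi (Set.univ : Set ι) (fun _ => Sp K (fun s : Finset (In N) => ptype s = τ + 1)))
      + finrank K ↥(Hom K (In N) (Finset.univ : Finset (In N)) k ⊓ (⨅ c, Kr K (Finset.univ : Finset (In N)) (f c) k) ⊓ Sp K (fun s : Finset (In N) => ptype s = τ))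
      = finrank K ↥(Hom K (In N) (Finset.univ : Finset (In N)) k ⊓ Sp K (fun s : Finset (In N) => ptype s = τ)) := by
  let P : Submodule K (HT K (In N)) := Hom K (In N) (Finset.univ : Finset (In N)) k ⊓ Sp K (fun s : Finset (In N) => ptype s = τ)
  let g : P →ₗ[K] (ι → HT K (In N)) := (L K f) ∘ₗ P.subtype
  have hrange : LinearMap.range g
      = JR K (In N) (Finset.univ : Finset (In N)) k f ⊓ Submodule.pi (Set.univ : Set ι) (fun _ => Sp K (fun s : Finset (In N) => ptype s = τ + 1)) := by
    rw [LinearMap.range_comp, Submodule.range_subtype, JR_inf_pi_Sp_ptype_succ_eq_map K τ hf k]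
  have hker : LinearMap.ker g
      = (Hom K (In N) (Finset.univ : Finset (In N)) k ⊓ (⨅ c, Kr K (Finset.univ : Finset (In N)) (f c) k) ⊓ Sp K (fun s : Finset (In N) => ptype s = τ)).comap P.subtype := by
    ext θ
    rw [LinearMap.mem_ker, Submodule.mem_comap, Submodule.subtype_apply, Submodule.mem_inf, Submodule.mem_inf, Submodule.mem_iInf, LinearMap.comp_apply,
      Submodule.subtype_apply]
    constructor
    · intro h0
      refine ⟨⟨θ.2.1, fun c => mem_Kr.mpr ⟨θ.2.1, ?_⟩⟩, θ.2.2⟩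
      have := congr_fun h0 c
      rwa [L_apply] at this
    · intro hθ
      funext c
      rw [L_apply]
      exact (mem_Kr.mp (hθ.1.2 c)).2
  have hle : Hom K (In N) (Finset.univ : Finset (In N)) k ⊓ (⨅ c, Kr K (Finset.univ : Finset (In N)) (f c) k) ⊓ Sp K (fun s : Finset (In N) => ptype s = τ) ≤ P :=
    inf_le_inf inf_le_left le_rfl
  have h := LinearMap.finrank_range_add_finrank_ker g
  rw [hrange, hker, (Submodule.comapSubtypeEquivOfLe hle).finrank_eq] at h
  exact h

omit [Fintype ι] [DecidableEq ι] in
/-- pair types with an EMPTY pair carry no joint image: `JR_k(f) ⊓ Π_c Sp(ptype = σ) = ⊥` if some `σ c = 0` (`f` transversal, `ι` non-empty). -/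
theorem JR_inf_pi_Sp_ptype_eq_bot_of_exists_zero [Nonempty ι] {σ : Fin N → ℕ} (hσ : ∃ c, σ c = 0) {f : ι → HT K (In N)} (hf : ∀ c, f c ∈ Sp K (Tr (N := N))) (k : ℕ) :
    JR K (In N) (Finset.univ : Finset (In N)) k f ⊓ Submodule.pi (Set.univ : Set ι) (fun _ => Sp K (fun s : Finset (In N) => ptype s = σ)) = ⊥ := by
  classical
  rw [Submodule.eq_bot_iff]
  rintro v ⟨hv, hvσ⟩
  obtain ⟨θ, -, rfl⟩ := hv
  rw [SetLike.mem_coe, Submodule.mem_pi] at hvσ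
  funext c
  rw [Pi.zero_apply, ← proj_eq_self (P := fun s : Finset (In N) => ptype s = σ) (fun s h => h) (hvσ c (Set.mem_univ c)), L_apply]
  exact proj_ptype_mul_eq_zero_of_exists_zero K hσ θ (hf c)

omit [Fintype ι] [DecidableEq ι] in
/-- pair types with a FULL pair carry no joint image either: `dim (JR_k(f) ⊓ Π_c Sp(ptype = τ + 𝟙)) = 0` if some `τ c ≥ 2` (`f` a finite transversal family). -/
theorem finrank_JR_inf_pi_Sp_ptype_succ_eq_zero_of_two_le {τ : Fin N → ℕ} {c₀ : Fin N} (h : 2 ≤ τ c₀) {f : ι → HT K (In N)} (hf : ∀ c, f c ∈ Sp K (Tr (N := N))) (k : ℕ) :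
    finrank K ↥(JR K (In N) (Finset.univ : Finset (In N)) k f ⊓ Submodule.pi (Set.univ : Set ι) (fun _ => Sp K (fun s : Finset (In N) => ptype s = τ + 1))) = 0 := by
  have h1 := finrank_JR_inf_pi_Sp_ptype_succ_add K τ hf k
  rw [Hom_iInf_Kr_inf_Sp_ptype_eq_Hom_inf_of_two_le K h hf k] at h1
  omega

/-! ## §402. The value for th-7's family: every `k`-set of pairs contributes exactly `rank [H_k(q_c)]_c` to the joint range -/

/-- **EVERY `k`-SET `A` OF PAIRS CONTRIBUTES EXACTLY THE BLOCK HANKEL RANK TO THE JOINT RANGE: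
`dim (JR_{|A|}((w_N q_c)_c) ⊓ Π_c Sp(ptype = 𝟙_A + 𝟙)) = rank (hank K N |A| q)`** for every finite family `q`, every set `A` of pairs and every field (uniform in `n`): the pure piece
on `A` has dimension `2^{|A|}`, its joint kernel `2^{|A|} − rank [H_{|A|}(q_c)]_c` (J2), and its joint image is the `𝟙_A + 𝟙`-piece of the joint range (§401). -/
theorem finrank_JR_w_inf_pi_Sp_pure_succ (A : Finset (Fin N)) (q : ι → ℕ → K) :
    finrank K ↥(JR K (In N) (Finset.univ : Finset (In N)) A.card (fun c => w K N N (q c))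
        ⊓ Submodule.pi (Set.univ : Set ι) (fun _ => Sp K (fun s : Finset (In N) => ptype s = (fun c => if c ∈ A then 1 else 0) + 1)))
      = (hank K N A.card (fun (_ : Unit) (c : ι) => q c)).rank := by
  have h1 := finrank_JR_inf_pi_Sp_ptype_succ_add K (fun c => if c ∈ A then 1 else 0) (f := fun c => w K N N (q c)) (fun c => w_mem_Sp_Tr K (q c)) A.card
  rw [Hom_inf_Sp_pure, finrank_Sp_pure] at h1
  have h2 := finrank_iInf_Kr_w_inf_Sp_pure_add K A q
  omega

/-- the same with the type spelled `c ↦ if c ∈ A then 2 else 1`: **`dim (JR_{|A|}((w_N q_c)_c) ⊓ Π_c Sp(ptype = [c ∈ A] + 1)) = rank (hank K N |A| q)`.** -/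
theorem finrank_JR_w_inf_pi_Sp_two_one (A : Finset (Fin N)) (q : ι → ℕ → K) :
    finrank K ↥(JR K (In N) (Finset.univ : Finset (In N)) A.card (fun c => w K N N (q c))
        ⊓ Submodule.pi (Set.univ : Set ι) (fun _ => Sp K (fun s : Finset (In N) => ptype s = fun c => if c ∈ A then 2 else 1)))
      = (hank K N A.card (fun (_ : Unit) (c : ι) => q c)).rank := by
  have e : (fun c : Fin N => if c ∈ A then (2 : ℕ) else 1) = (fun c : Fin N => if c ∈ A then 1 else 0) + 1 := by
    funext c
    simp only [Pi.add_apply, Pi.one_apply]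
    split_ifs <;> rfl
  rw [← finrank_JR_w_inf_pi_Sp_pure_succ K A q, e]

end Summit.Ventures.HSemireg.Wedge.HankelOuter
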